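import Literature.Algebra.Homology.OrderedCechLexSystem
import Literature.Algebra.Homology.OrderedCechPairSystemComplex
import Literature.Algebra.Homology.OrderedCechSystemAugment
import HarnessLib

/-!
# The lexicographic Čech resolvent of a pair-system: `Q^q(s, t) = Čq(T ↦ P (s ∪ π₁T) (t ∪ π₂T))` (Stacks 0BEC, 01FG)

Layer `Literature/Algebra/Homology` (constructions + `rfl`/functoriality API; 0 named facts, no instance, no notation; pure homological algebra over a
commutative ring `A`).  For a pair-system `P : Finset ι ⥤ Finset κ ⥤ ModuleCat A` (`Algebra/Homology/OrderedCechPairSystem`; `(s, t) ↦ Γ(U_s × V_t, 𝓕)`)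
the ordered Čech complex of the PRODUCT COVER indexed by `ι ×ₗ κ` is `Č•(lexSystem P)` (`Algebra/Homology/OrderedCechLexSystem`, `T ↦ P (π₁T) (π₂T)`).
To compare it with the total complex of the Čech BICOMPLEX `Č•,•(P)` through the resolution criterion `OrderedCech.homologyIsoEmptyComplexOfSystems`
(`Algebra/Homology/OrderedCechPairSystemComparison`) one Čech-resolves EVERY member `P s t` in the lexicographic direction; this file builds that datum:

* `unionLeft s : s' ↦ s ∪ s'`, **`pairShift P s t = (s', t') ↦ P (s ∪ s') (t ∪ t')`**, `pairShiftMap` (restriction in the shifts; `restrict_comp` normalises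
  composites of restrictions), `pairShiftBifunctor P : (s, t) ↦ pairShift P s t`, `pairShiftEmptyIso : pairShift P ∅ ∅ ≅ P`;
* `lexSystemFunctor` (packaging `OrderedCechLexSystem.lexSystemMap`), **`lexShift P s t = lexSystem (pairShift P s t) = T ↦ P (s ∪ π₁T) (t ∪ π₂T)`**,
  `lexShiftMap`, `lexShiftBifunctor P : (s, t) ↦ lexShift P s t` (its slices `t ↦ P (s ∪ π₁T) (t ∪ π₂T)`, `s ↦ …` at fixed `T` are the systems with
  apex vertices `j₀ ∈ π₂T`, `i₀ ∈ π₁T`);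
* **`lexResolvent P : CochainComplex (Finset ι ⥤ Finset κ ⥤ ModuleCat A) ℤ`**, `q ↦ ((s, t) ↦ Čq(lexShift P s t))` with the lexicographic Čech differential
  (`lexResolventX`, `lexResolventD`; the pattern of `OrderedCechPairSystem.sysBicomplex` one variable up), `lexResolvent_d_app_app` (its `(s, t)`-component IS
  `Č•(lexShift P s t)`);
* **`lexResolventAugment P : P ⟶ (lexResolvent P)⁰`**, `(s, t) ↦ (P s t → P (s ∪ ∅) (t ∪ ∅) = (lexShift P s t) ∅ —sysAugment→ Č⁰)` (`toShiftEmpty`);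
* **`lexCornerIso P : emptyComplex (lexResolvent P) ≅ Č•(lexShift P ∅ ∅)`**, `lexShiftEmptyIso P : lexShift P ∅ ∅ ≅ lexSystem P` (the corner = the product cover).

Exactness of the datum ((R), (Cκ), (Cι) by apex vertices, `Algebra/Homology/OrderedCechSystemCone`) and the comparison `Hⁿ(Tot Č•,•(P)) ≅ Hⁿ(Č•(lexSystem P))`
(Eilenberg–Zilber for the product cover without acyclic models; Stacks 0BEC compares both sides with cohomology instead) are the sequel
`Algebra/Homology/OrderedCechPairSystemLexComparison`.  Library only (cell `hodgecm-mathlib`, F-11/J3 Künneth packet (S1′) road α, DEF file #7 of record;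
count-neutral); proves nothing about any crux, route or conjecture.  Mathlib searched (pin v4.32): `Monotone.functor`, `Functor.whiskerLeft/Right`,
`whiskeringLeft/Right`, `whiskeringLeftObjIdIso`, `leftUnitor`, `NatIso.ofComponents`, `CochainComplex.of_d`, `Hom.isoOfComponents` (used).

## References

* The Stacks Project, Tag 0BEC (Künneth: the double Čech complex of two coverings), Tag 01FG (ordered Čech complex), Tag 0133. [StacksProject]
* U. Görtz, T. Wedhorn, *Algebraic Geometry II* (2023), Def. 21.64, Lemma 21.65, Def. 21.68 (pp. 179–180). [GortzWedhorn2023]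
-/

universe u

open CategoryTheory CategoryTheory.Limits HomologicalComplex

set_option backward.isDefEq.respectTransparency false

noncomputable section

namespace Literature.Algebra.Homology

namespace OrderedCech

variable {A : Type u} [CommRing A] {ι κ : Type} [LinearOrder ι] [LinearOrder κ]

/-! ### §1 Union functors and the shifted pair-system -/

/-- **`s' ↦ s ∪ s'`** as an endofunctor of the poset `Finset ι`. [cite: GortzWedhorn2023, Def. 21.64 (p. 179)] -/
def unionLeft (s : Finset ι) : Finset ι ⥤ Finset ι :=
  Monotone.functor (f := fun s' => s ∪ s') fun _ _ h => Finset.union_subset_union_right h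

/-- `s ⊆ s'` induces `unionLeft s ⟶ unionLeft s'` (componentwise `s ∪ s'' ⊆ s' ∪ s''`). [cite: GortzWedhorn2023, Def. 21.64 (p. 179)] -/
def unionLeftMap {s s' : Finset ι} (h : s ⊆ s') : unionLeft s ⟶ unionLeft s' where
  app _ := homOfLE (Finset.union_subset_union_left h)
  naturality _ _ _ := Subsingleton.elim _ _

/-- `unionLeft ∅ ≅ 𝟭` (`∅ ∪ s' = s'`). [cite: GortzWedhorn2023, Def. 21.64 (p. 179)] -/
def unionLeftEmptyIso : unionLeft (∅ : Finset ι) ≅ 𝟭 (Finset ι) :=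
  NatIso.ofComponents (fun s' => eqToIso (Finset.empty_union s')) fun _ => Subsingleton.elim _ _

variable (P : Finset ι ⥤ Finset κ ⥤ ModuleCat.{u} A)

/-- **The shifted pair-system `(s', t') ↦ P (s ∪ s') (t ∪ t')`** (precomposition with `unionLeft s`, `unionLeft t`).
[cite: StacksProject, Tag 0BEC] [cite: GortzWedhorn2023, Def. 21.64 (p. 179)] -/
def pairShift (s : Finset ι) (t : Finset κ) : Finset ι ⥤ Finset κ ⥤ ModuleCat.{u} A :=
  unionLeft s ⋙ P ⋙ (Functor.whiskeringLeft _ _ _).obj (unionLeft t)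

/-- `(pairShift P s t) s' t' = P (s ∪ s') (t ∪ t')` (`rfl`). [cite: StacksProject, Tag 0BEC] -/
@[simp] theorem pairShift_obj_obj (s s' : Finset ι) (t t' : Finset κ) :
    ((pairShift P s t).obj s').obj t' = (P.obj (s ∪ s')).obj (t ∪ t') := rfl

omit [LinearOrder ι] [LinearOrder κ] in
/-- **Composites of restrictions of a pair-system normalise**: (restrict in `s`, then in `t`) twice = once (any choice of the
composite inclusions; bifunctoriality of `P`). [cite: StacksProject, Tag 0BEC] [cite: GortzWedhorn2023, Def. 21.64 (p. 179)] -/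
theorem restrict_comp {s₁ s₂ s₃ : Finset ι} {t₁ t₂ t₃ : Finset κ} (f : s₁ ⟶ s₂) (f' : s₂ ⟶ s₃) (g : t₁ ⟶ t₂) (g' : t₂ ⟶ t₃)
    (f'' : s₁ ⟶ s₃) (g'' : t₁ ⟶ t₃) :
    ((P.map f).app t₁ ≫ (P.obj s₂).map g) ≫ (P.map f').app t₂ ≫ (P.obj s₃).map g' = (P.map f'').app t₁ ≫ (P.obj s₃).map g'' := by
  rw [Subsingleton.elim f'' (f ≫ f'), Subsingleton.elim g'' (g ≫ g'), P.map_comp, NatTrans.comp_app, (P.obj s₃).map_comp]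
  simp only [Category.assoc, NatTrans.naturality_assoc]

omit [LinearOrder ι] [LinearOrder κ] in
/-- A restriction in `t` alone, in the normal form «restrict in `s` (identity), then in `t`». [cite: StacksProject, Tag 0BEC] -/
theorem obj_map_eq_restrict (s₁ : Finset ι) {t₁ t₂ : Finset κ} (g : t₁ ⟶ t₂) :
    (P.obj s₁).map g = (P.map (𝟙 s₁)).app t₁ ≫ (P.obj s₁).map g := by
  rw [P.map_id, NatTrans.id_app, Category.id_comp]

omit [LinearOrder ι] [LinearOrder κ] in
/-- A restriction in `s` alone, in the normal form «restrict in `s`, then in `t` (identity)». [cite: StacksProject, Tag 0BEC] -/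
theorem map_app_eq_restrict {s₁ s₂ : Finset ι} (f : s₁ ⟶ s₂) (t₁ : Finset κ) :
    (P.map f).app t₁ = (P.map f).app t₁ ≫ (P.obj s₂).map (𝟙 t₁) := by
  rw [(P.obj s₂).map_id, Category.comp_id]

/-- **Restriction in the shifts**: `pairShift P s t ⟶ pairShift P s' t'` for `s ⊆ s'`, `t ⊆ t'`. [cite: StacksProject, Tag 0BEC] -/
def pairShiftMap {s s' : Finset ι} {t t' : Finset κ} (hs : s ⊆ s') (ht : t ⊆ t') : pairShift P s t ⟶ pairShift P s' t' :=
  Functor.whiskerRight (unionLeftMap hs) (P ⋙ (Functor.whiskeringLeft _ _ _).obj (unionLeft t)) ≫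
    Functor.whiskerLeft (unionLeft s') (Functor.whiskerLeft P ((Functor.whiskeringLeft _ _ _).map (unionLeftMap ht)))

/-- Components of `pairShiftMap`: restrict in the first variable, then in the second (`rfl`). [cite: StacksProject, Tag 0BEC] -/
theorem pairShiftMap_app_app {s s' : Finset ι} {t t' : Finset κ} (hs : s ⊆ s') (ht : t ⊆ t') (s'' : Finset ι) (t'' : Finset κ) :
    ((pairShiftMap P hs ht).app s'').app t'' =
      (P.map (homOfLE (Finset.union_subset_union_left hs))).app (t ∪ t'') ≫
        (P.obj (s' ∪ s'')).map (homOfLE (Finset.union_subset_union_left ht)) := rfl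

/-- `pairShiftMap` at `(⊆-refl, ⊆-refl)` is the identity. [cite: StacksProject, Tag 0BEC] -/
theorem pairShiftMap_refl (s : Finset ι) (t : Finset κ) :
    pairShiftMap P (subset_refl s) (subset_refl t) = 𝟙 (pairShift P s t) := by
  ext s'' t'' : 4
  rw [pairShiftMap_app_app, NatTrans.id_app, NatTrans.id_app]
  change (P.map (𝟙 (s ∪ s''))).app (t ∪ t'') ≫ (P.obj (s ∪ s'')).map (𝟙 (t ∪ t'')) = 𝟙 ((P.obj (s ∪ s'')).obj (t ∪ t''))
  rw [P.map_id, NatTrans.id_app, (P.obj (s ∪ s'')).map_id, Category.id_comp]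

/-- `pairShiftMap` is transitive. [cite: StacksProject, Tag 0BEC] -/
theorem pairShiftMap_comp {s s' s'' : Finset ι} {t t' t'' : Finset κ} (hs : s ⊆ s') (hs' : s' ⊆ s'') (ht : t ⊆ t')
    (ht' : t' ⊆ t'') :
    pairShiftMap P hs ht ≫ pairShiftMap P hs' ht' = pairShiftMap P (hs.trans hs') (ht.trans ht') := by
  ext u v : 4
  rw [NatTrans.comp_app, NatTrans.comp_app, pairShiftMap_app_app, pairShiftMap_app_app, pairShiftMap_app_app]
  exact restrict_comp P _ _ _ _ _ _

/-- **`(s, t) ↦ pairShift P s t` as a bifunctor in the shifts** (maps `pairShiftMap`). [cite: StacksProject, Tag 0BEC] -/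
def pairShiftBifunctor : Finset ι ⥤ Finset κ ⥤ (Finset ι ⥤ Finset κ ⥤ ModuleCat.{u} A) where
  obj s :=
    { obj := fun t => pairShift P s t
      map := fun h => pairShiftMap P (subset_refl s) h.le
      map_id := fun t => pairShiftMap_refl P s t
      map_comp := fun f g => (pairShiftMap_comp P (subset_refl s) (subset_refl s) f.le g.le).symm }
  map h := { app := fun t => pairShiftMap P h.le (subset_refl t), naturality := fun _ _ k => by rw [pairShiftMap_comp, pairShiftMap_comp] }
  map_id s := by ext t : 2; exact pairShiftMap_refl P s t
  map_comp f g := by ext t : 2; exact (pairShiftMap_comp P f.le g.le (subset_refl t) (subset_refl t)).symm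

/-- **`pairShift P ∅ ∅ ≅ P`** (`∅ ∪ s' = s'`, `∅ ∪ t' = t'`). [cite: StacksProject, Tag 0BEC] -/
def pairShiftEmptyIso : pairShift P ∅ ∅ ≅ P :=
  Functor.isoWhiskerRight unionLeftEmptyIso (P ⋙ (Functor.whiskeringLeft _ _ _).obj (unionLeft ∅)) ≪≫
    (P ⋙ (Functor.whiskeringLeft _ _ _).obj (unionLeft ∅)).leftUnitor ≪≫
      Functor.isoWhiskerLeft P ((Functor.whiskeringLeft _ _ _).mapIso unionLeftEmptyIso ≪≫ Functor.whiskeringLeftObjIdIso) ≪≫ P.rightUnitor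

/-! ### §2 The lex-shifted systems `T ↦ P (s ∪ π₁T) (t ∪ π₂T)` -/

variable (A ι κ) in
/-- **`P ↦ lexSystem P` as a functor** from pair-systems to systems on `Finset (ι ×ₗ κ)`. [cite: StacksProject, Tag 0BEC] -/
def lexSystemFunctor : (Finset ι ⥤ Finset κ ⥤ ModuleCat.{u} A) ⥤ (Finset (ι ×ₗ κ) ⥤ ModuleCat.{u} A) where
  obj P := lexSystem P
  map φ := lexSystemMap φ
  map_id P := lexSystemMap_id P
  map_comp φ ψ := lexSystemMap_comp φ ψ

/-- **`lexShift P s t = lexSystem (pairShift P s t) = T ↦ P (s ∪ π₁T) (t ∪ π₂T)`.** [cite: StacksProject, Tag 0BEC] [cite: GortzWedhorn2023, Def. 21.64 (p. 179)] -/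
abbrev lexShift (s : Finset ι) (t : Finset κ) : Finset (ι ×ₗ κ) ⥤ ModuleCat.{u} A := lexSystem (pairShift P s t)

/-- Restriction of the lex-shifted systems in the shifts. [cite: StacksProject, Tag 0BEC] -/
abbrev lexShiftMap {s s' : Finset ι} {t t' : Finset κ} (hs : s ⊆ s') (ht : t ⊆ t') : lexShift P s t ⟶ lexShift P s' t' :=
  lexSystemMap (pairShiftMap P hs ht)

/-- `lexShiftMap` at `(refl, refl)` is the identity. [cite: StacksProject, Tag 0BEC] -/
@[simp] theorem lexShiftMap_refl (s : Finset ι) (t : Finset κ) : lexShiftMap P (subset_refl s) (subset_refl t) = 𝟙 (lexShift P s t) := by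
  rw [lexShiftMap, pairShiftMap_refl]; rfl

/-- `lexShiftMap` is transitive. [cite: StacksProject, Tag 0BEC] -/
theorem lexShiftMap_comp {s s' s'' : Finset ι} {t t' t'' : Finset κ} (hs : s ⊆ s') (hs' : s' ⊆ s'') (ht : t ⊆ t') (ht' : t' ⊆ t'') :
    lexShiftMap P hs ht ≫ lexShiftMap P hs' ht' = lexShiftMap P (hs.trans hs') (ht.trans ht') := by
  rw [lexShiftMap, lexShiftMap, lexShiftMap, ← pairShiftMap_comp P hs hs' ht ht']; rfl

/-- **`(s, t) ↦ lexShift P s t` as a bifunctor in the shifts**; its slices `((lexShiftBifunctor P).obj s) ⋙ ev_T = t ↦ P (s ∪ π₁T) (t ∪ π₂T)` and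
`((lexShiftBifunctor P).flip.obj t) ⋙ ev_T = s ↦ P (s ∪ π₁T) (t ∪ π₂T)` are the systems the comparison contracts. [cite: StacksProject, Tag 0BEC] -/
def lexShiftBifunctor : Finset ι ⥤ Finset κ ⥤ (Finset (ι ×ₗ κ) ⥤ ModuleCat.{u} A) :=
  pairShiftBifunctor P ⋙ (Functor.whiskeringRight _ _ _).obj (lexSystemFunctor A ι κ)

/-- The values of `lexShiftBifunctor` (`rfl`). [cite: StacksProject, Tag 0BEC] -/
@[simp] theorem lexShiftBifunctor_obj_obj (s : Finset ι) (t : Finset κ) : ((lexShiftBifunctor P).obj s).obj t = lexShift P s t := rfl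

/-- The maps of `lexShiftBifunctor` in `t` (`rfl`). [cite: StacksProject, Tag 0BEC] -/
theorem lexShiftBifunctor_obj_map (s : Finset ι) {t t' : Finset κ} (h : t ⟶ t') :
    ((lexShiftBifunctor P).obj s).map h = lexShiftMap P (subset_refl s) h.le := rfl

/-- The maps of `lexShiftBifunctor` in `s` (`rfl`). [cite: StacksProject, Tag 0BEC] -/
theorem lexShiftBifunctor_map_app {s s' : Finset ι} (h : s ⟶ s') (t : Finset κ) :
    ((lexShiftBifunctor P).map h).app t = lexShiftMap P h.le (subset_refl t) := rfl

/-! ### §3 The lexicographic Čech resolvent `q ↦ ((s, t) ↦ Čq(lexShift P s t))` -/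

/-- **The pair-system `(s, t) ↦ Čq(lexShift P s t)`** of lexicographic `q`-cochains (restrictions in the shifts). [cite: StacksProject, Tag 0BEC]
[cite: GortzWedhorn2023, Def. 21.68 (p. 180)] -/
def lexResolventX (q : ℤ) : Finset ι ⥤ Finset κ ⥤ ModuleCat.{u} A :=
  lexShiftBifunctor P ⋙ (Functor.whiskeringRight _ _ _).obj (sysCochainFunctor A (ι ×ₗ κ) q)

/-- The members of `lexResolventX` (`rfl`). [cite: StacksProject, Tag 0BEC] -/
@[simp] theorem lexResolventX_obj_obj (q : ℤ) (s : Finset ι) (t : Finset κ) :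
    ((lexResolventX P q).obj s).obj t = ModuleCat.of A (SysCochain (lexShift P s t) q) := rfl

/-- **The lexicographic Čech differential `Čq(lexShift P s t) → Čq⁺¹(lexShift P s t)` as a morphism of pair-systems** (natural in the shifts by
`sysD_sysCochainMap`). [cite: GortzWedhorn2023, Def. 21.68 (p. 180)] [cite: StacksProject, Tag 0BEC] -/
def lexResolventD (q : ℤ) : lexResolventX P q ⟶ lexResolventX P (q + 1) where
  app s :=
    { app := fun t => ModuleCat.ofHom (sysD (lexShift P s t) q)
      naturality := fun {t t'} h => by ext g; exact sysD_sysCochainMap (lexShiftMap P (subset_refl s) h.le) g }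
  naturality {s s'} h := by ext t g; exact sysD_sysCochainMap (lexShiftMap P h.le (subset_refl t)) g

/-- Components of `lexResolventD` (`rfl`). [cite: GortzWedhorn2023, Def. 21.68 (p. 180)] -/
@[simp] theorem lexResolventD_app_app (q : ℤ) (s : Finset ι) (t : Finset κ) :
    ((lexResolventD P q).app s).app t = ModuleCat.ofHom (sysD (lexShift P s t) q) := rfl

/-- **The lexicographic Čech resolvent** `q ↦ ((s, t) ↦ Čq(lexShift P s t))`, a cochain complex of pair-systems. [cite: StacksProject, Tag 0BEC]
[cite: StacksProject, Tag 0133] -/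
def lexResolvent : CochainComplex (Finset ι ⥤ Finset κ ⥤ ModuleCat.{u} A) ℤ :=
  CochainComplex.of (lexResolventX P) (lexResolventD P) fun q => by ext s t g; exact sysD_sysD (lexShift P s t) q g

/-- The differential of the resolvent is `lexResolventD`. [cite: StacksProject, Tag 0BEC] -/
theorem lexResolvent_d (q : ℤ) : (lexResolvent P).d q (q + 1) = lexResolventD P q := by
  change CochainComplex.of.d (V := Finset ι ⥤ Finset κ ⥤ ModuleCat.{u} A) (lexResolventX P) (lexResolventD P) q (q + 1) = _
  exact CochainComplex.of_d _ _ q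

/-- **The `(s, t)`-component of the resolvent IS the Čech complex `Č•(lexShift P s t)`** (all pairs of degrees). [cite: StacksProject, Tag 0BEC]
[cite: GortzWedhorn2023, Def. 21.68 (p. 180)] -/
theorem lexResolvent_d_app_app (i j : ℤ) (s : Finset ι) (t : Finset κ) :
    (((lexResolvent P).d i j).app s).app t = (sysComplex (lexShift P s t)).d i j := by
  by_cases hij : i + 1 = j
  · subst hij
    rw [lexResolvent_d, lexResolventD_app_app, sysComplex_d]
  · rw [(lexResolvent P).shape i j hij, (sysComplex (lexShift P s t)).shape i j hij]
    rfl

/-! ### §5 The augmentation `P ⟶ (lexResolvent P)⁰` and the corner -/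

/-- `P s t → P (s ∪ π₁∅) (t ∪ π₂∅) = (lexShift P s t) ∅`: restriction along `s ⊆ s ∪ π₁∅`, `t ⊆ t ∪ π₂∅` (both inclusions are
equalities, so this is a bijection). [cite: StacksProject, Tag 0BEC] -/
def toShiftEmpty (s : Finset ι) (t : Finset κ) : (P.obj s).obj t ⟶ (lexShift P s t).obj ∅ :=
  (P.map (homOfLE Finset.subset_union_left)).app t ≫ (P.obj (s ∪ fstProj ∅)).map (homOfLE Finset.subset_union_left)

/-- The augmentation `ε` of a system followed by a map of systems is the map at `∅` followed by `ε` (morphism form of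
`sysCochainMap_sysAugment`). [cite: GortzWedhorn2023, Lemma 21.65 (p. 179)] -/
theorem ofHom_sysAugment_comp_sysCochainMap {M M' : Finset (ι ×ₗ κ) ⥤ ModuleCat.{u} A} (φ : M ⟶ M') :
    ModuleCat.ofHom (sysAugment M) ≫ ModuleCat.ofHom (sysCochainMap φ 0) = φ.app ∅ ≫ ModuleCat.ofHom (sysAugment M') := by
  ext g
  exact sysCochainMap_sysAugment φ g

/-- **The augmentation `ε : P ⟶ (lexResolvent P)⁰`**, `(s, t) ↦ (P s t → (lexShift P s t) ∅ —sysAugment→ Č⁰(lexShift P s t))`; natural in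
the shifts because all composites of restrictions of `P` agree (`restrict_comp`). [cite: GortzWedhorn2023, Lemma 21.65 (p. 179)]
[cite: StacksProject, Tag 0BEC] -/
def lexResolventAugment : P ⟶ (lexResolvent P).X 0 where
  app s :=
    { app := fun t => toShiftEmpty P s t ≫ ModuleCat.ofHom (sysAugment (lexShift P s t))
      naturality := fun {t t'} h => by
        change (P.obj s).map h ≫ toShiftEmpty P s t' ≫ ModuleCat.ofHom (sysAugment (lexShift P s t')) =
          (toShiftEmpty P s t ≫ ModuleCat.ofHom (sysAugment (lexShift P s t))) ≫
            ModuleCat.ofHom (sysCochainMap (lexShiftMap P (subset_refl s) h.le) 0)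
        rw [Category.assoc, ofHom_sysAugment_comp_sysCochainMap, ← Category.assoc, ← Category.assoc]
        congr 1
        rw [toShiftEmpty, toShiftEmpty, lexSystemMap_app, pairShiftMap_app_app, obj_map_eq_restrict P s h]
        exact (restrict_comp P _ _ _ _ (homOfLE Finset.subset_union_left)
          (homOfLE (h.le.trans Finset.subset_union_left))).trans (restrict_comp P _ _ _ _ _ _).symm }
  naturality {s s'} h := by
    ext t : 2
    change (P.map h).app t ≫ toShiftEmpty P s' t ≫ ModuleCat.ofHom (sysAugment (lexShift P s' t)) =
      (toShiftEmpty P s t ≫ ModuleCat.ofHom (sysAugment (lexShift P s t))) ≫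
        ModuleCat.ofHom (sysCochainMap (lexShiftMap P h.le (subset_refl t)) 0)
    rw [Category.assoc, ofHom_sysAugment_comp_sysCochainMap, ← Category.assoc, ← Category.assoc]
    congr 1
    rw [toShiftEmpty, toShiftEmpty, lexSystemMap_app, pairShiftMap_app_app, map_app_eq_restrict P h t]
    exact (restrict_comp P _ _ _ _ (homOfLE (h.le.trans Finset.subset_union_left))
      (homOfLE Finset.subset_union_left)).trans (restrict_comp P _ _ _ _ _ _).symm

/-- Components of the augmentation (`rfl`). [cite: GortzWedhorn2023, Lemma 21.65 (p. 179)] -/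
theorem lexResolventAugment_app_app (s : Finset ι) (t : Finset κ) :
    ((lexResolventAugment P).app s).app t = toShiftEmpty P s t ≫ ModuleCat.ofHom (sysAugment (lexShift P s t)) := rfl

/-- **The corner complex of the resolvent is the Čech complex of `lexShift P ∅ ∅`** (same terms, same differentials).
[cite: StacksProject, Tag 0BEC] [cite: StacksProject, Tag 0133] -/
def lexCornerIso : emptyComplex (lexResolvent P) ≅ sysComplex (lexShift P ∅ ∅) :=
  Hom.isoOfComponents (fun _ => Iso.refl _) fun i j hij => by
    rw [Iso.refl_hom, Iso.refl_hom, Category.id_comp, Category.comp_id]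
    exact (lexResolvent_d_app_app P i j ∅ ∅).symm

/-- **`lexShift P ∅ ∅ ≅ lexSystem P`** — the corner system is the Čech system of the product cover. [cite: StacksProject, Tag 0BEC] -/
def lexShiftEmptyIso : lexShift P ∅ ∅ ≅ lexSystem P := (lexSystemFunctor A ι κ).mapIso (pairShiftEmptyIso P)

end OrderedCech

end Literature.Algebra.Homology

end
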